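import Mathlib.Analysis.InnerProductSpace.PiL2
import Mathlib.Analysis.InnerProductSpace.Projection.FiniteDimensional
import Mathlib.Topology.Algebra.Order.Field
import Literature.Geometry.DiscreteGeometry.RankinOrthoplexBound
import Literature.Geometry.DiscreteGeometry.SphericalCodeContactGraph
import HarnessLib

/-!
# Irreducibility of maximal arrangements: shifts at low degree, Danzer flips, degrees
# `0, 3, 4, 5` (Musin–Tarasov 2012, §2.1, Propositions 3.2–3.3, Corollary 3.1) — proved

Topic `Literature/Geometry/DiscreteGeometry`; brick 3b, in printed order, of the proof of
Theorem 1 of O. R. Musin, A. S. Tarasov, *The strong thirteen spheres problem*, Discrete Comput.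
Geom. 48 (2012) 128–141 [`MusinTarasov2012`] (named fact `musinTarasov2012_tammes_thirteen`),
after `SphericalCodeContactGraph.lean` (Props 3.1, 3.3 upper, 3.6–3.7), `SphericalCodeOptimal.lean`
(ψ, `d_N`, maximal arrangements with the fewest edges, shifts, Prop 3.2 shift half) and
`RankinOrthoplexBound.lean` (`d_N < 90°` for `N ≥ 7`, `d_N > 0`).  This file completes
**Proposition 3.2** (irreducibility, quoted by Musin–Tarasov from Danzer 1986) for the
maximal arrangements with the fewest edges, and with it the degree clause of **Corollary 3.1**.
Everything is a definition or PROVED; no named facts.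

## Source (verbatim, arXiv:1002.1439v3, §2.1 and §3.1)

* "**Danzer's flip.** Danzer [Dan] defined the following flip. Let `x, y, z` be vertices of
  `CG(X)` with `dist(x, y) = dist(x, z) = ψ(X)`. We say that `x` is flipped over `yz` if `x` is
  replaced by its mirror image `x′` relative to the great circle `yz`. We say that this flip is
  Danzer's flip if `dist(x′, X ∖ {x, y, z}) > ψ(X)`.  **Irreducible graphs.** We say that the
  graph `CG(X)` is irreducible (or jammed) if there are neither Danzer's flips nor shifts of
  vertices."
* "**Proposition 3.2.** Let `X` be a subset of `S²` with `|X| = N` and `ψ(X) = d_N`. Then for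
  `N > 6` the graph `CG(X)` is irreducible.  **Proposition 3.3.** Let `X ⊂ S²`. If the graph
  `CG(X)` is irreducible, then degrees of its vertices can take only the values `0` (isolated
  vertices), `3`, `4`, or `5`."  "The following three propositions are proved in [Dan] (also see
  [FeT], [BS, BS14])."  Corollary 3.1: "Any vertex of `G₁₃` is of degree `0, 3, 4,` or `5`".

## What is proved, and in which form

As in the previous bricks, configurations are labelled (`x : Fin N → E`), distances chordal, and
shifts are in RELOCATION form (`HasShift`, `SphericalCodeOptimal.lean`), which makes the
irreducibility proved here STRONGER than the printed notion.  The printed Proposition 3.2 is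
stated for every maximal arrangement; what the sequel (and Böröczky–Szabó, and the enumeration
of §4) uses, and what is proved here, is irreducibility of the maximal arrangements with the
minimal number of contact edges (`IsTammesOptimal`, which exist: `exists_isTammesOptimal`).

* Part A: `contactNbrs x i` (the contact neighbours of a label; `mem_contactNbrs_iff` links to
  `contactPairs`), `two_mul_card_contactNbrs_add_le` (the `2·deg(i)` darts at `i` plus the contact
  pairs avoiding `i` are distinct contact pairs).
* Part B: strict chordal dictionary `lt_dist_iff_inner_lt_of_unit`,
  `dist_eq_dist_iff_inner_eq_of_unit`.
* Part C — **shifts exist at vertices of low degree** (`ψ < √2`, i.e. contacts at `< 90°`):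
  `hasShift_of_exists_orthogonal` (a nonzero normal `n` to all contact neighbours gives the shift
  `(x i + ε n)/‖x i + ε n‖`, `ε → 0⁺`: contacts recede because `‖x i + ε n‖ > 1` and
  `⟪x i, x j⟫ > 0`, non-contacts stay `> ψ` by continuity),
  `hasShift_of_card_contactNbrs_lt_finrank` (fewer contacts than the dimension), `hasShift_of_card_contactNbrs_le_two` (`S²`: degree `≤ 2`).
* Part D — **Danzer flips**: `flipPoint a b z` (the reflection of `z` in the plane of the unit
  vectors `a, b`, written out; `inner_flipPoint_left/right`: it fixes the inner products with
  `a, b`; `norm_flipPoint`: it is an isometry), `HasDanzerFlip x i` (verbatim the definition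
  above), `IsIrreducible x` (no shift at a vertex of positive degree, no Danzer flip anywhere),
  `sq_inner_lt_one_of_contactNbrs` (two contact neighbours are neither equal nor antipodal when
  `0 < ψ < √2`), and **Proposition 3.2, flip half**:
  `IsTammesOptimal.not_hasDanzerFlip_of_three_le` — at a vertex of degree `≥ 3` a Danzer flip
  would keep `ψ` (maximality) and replace the `2·deg ≥ 6` darts at `i` by the `4` darts to the two
  mirror vertices, contradicting minimality of the number of contact pairs.
* Part E — **`S² ⊂ ℝ³`, `N ≥ 7`** (`0 < ψ = d_N < √2` by `RankinOrthoplexBound.lean`):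
  `IsTammesOptimal.card_contactNbrs_eq_zero_or_three_le` (degrees `1, 2` are shiftable, hence
  absent), `card_contactNbrs_le_five` (Prop 3.3 upper part, from `card_le_five_of_neighbours`),
  **`IsTammesOptimal.isIrreducible` (Proposition 3.2)**, `IsTammesOptimal.card_contactNbrs_mem`
  (**degrees `∈ {0, 3, 4, 5}`**, Proposition 3.3 / Corollary 3.1), and the existence statement
  `exists_isTammesOptimal_isIrreducible` that §§3.2–4 start from.

Not here (next bricks): faces of the contact fan (Prop 3.4: at most `⌊2π/d_N⌋`-gons; Prop 3.5:
isolated vertices lie in hexagons), the face geometry of §3.2, the enumeration of §4, §5.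

## References

* O. R. Musin, A. S. Tarasov, Discrete Comput. Geom. 48 (2012) 128–141 = arXiv:1002.1439, §2.1,
  Propositions 3.2, 3.3, Corollary 3.1. [`MusinTarasov2012`]
* L. Danzer, *Finite point-sets on `S²` with minimum distance as large as possible*, Discrete
  Math. 60 (1986) 3–66 (the source of Propositions 3.2–3.4).
* R. A. Rankin, Proc. Glasgow Math. Assoc. 2 (1955) 139–144, Theorem 1 (iv). [`Rankin1955`]
-/

noncomputable section

namespace Literature.Geometry.DiscreteGeometry

open RealInnerProductSpace Module Finset Filter Topology

/-! ### Part A. Contact neighbours of a label -/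

section Nbrs

variable {α : Type*} [MetricSpace α] {N : ℕ}

/-- The contact neighbours of the label `i`: the labels `j ≠ i` with `dist (x i) (x j) = ψ(x)`
(the neighbours of `x i` in the contact graph `CG(x)`). [cite: MusinTarasov2012, §2.1] -/
def contactNbrs (x : Fin N → α) (i : Fin N) : Finset (Fin N) :=
  Finset.univ.filter (fun j => j ≠ i ∧ dist (x i) (x j) = minDist x)

/-- Membership in `contactNbrs`. [cite: MusinTarasov2012, §2.1] -/
theorem mem_contactNbrs {x : Fin N → α} {i j : Fin N} :
    j ∈ contactNbrs x i ↔ j ≠ i ∧ dist (x i) (x j) = minDist x := by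
  simp [contactNbrs]

/-- `j` is a contact neighbour of `i` iff `(i, j)` is a contact pair.
[cite: MusinTarasov2012, §2.1] -/
theorem mem_contactNbrs_iff {x : Fin N → α} {i j : Fin N} :
    j ∈ contactNbrs x i ↔ (i, j) ∈ contactPairs x := by
  rw [mem_contactNbrs, mem_contactPairs]
  exact ⟨fun h => ⟨h.1.symm, h.2⟩, fun h => ⟨h.1.symm, h.2⟩⟩

/-- The degree (number of contact neighbours) as twice-counted contact pairs at `i`: the darts
`(i, j)` and `(j, i)`, `j ∈ contactNbrs x i`, are `2 · deg` distinct contact pairs. [folklore] -/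
theorem two_mul_card_contactNbrs_add_le (x : Fin N → α) (i : Fin N) :
    2 * (contactNbrs x i).card +
        ((contactPairs x).filter (fun p => p.1 ≠ i ∧ p.2 ≠ i)).card ≤ (contactPairs x).card := by
  classical
  set R₁ := (contactNbrs x i).image (fun j => (i, j)) with hR₁
  set R₂ := (contactNbrs x i).image (fun j => (j, i)) with hR₂
  set F := (contactPairs x).filter (fun p => p.1 ≠ i ∧ p.2 ≠ i) with hF
  have h1 : R₁.card = (contactNbrs x i).card :=
    Finset.card_image_of_injective _ (Prod.mk_right_injective i)
  have h2 : R₂.card = (contactNbrs x i).card :=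
    Finset.card_image_of_injective _ fun a b h => by simpa using congrArg Prod.fst h
  have hd12 : Disjoint R₁ R₂ := by
    rw [Finset.disjoint_left]
    intro p hp1 hp2
    obtain ⟨j, hj, rfl⟩ := Finset.mem_image.1 hp1
    obtain ⟨k, -, hk⟩ := Finset.mem_image.1 hp2
    have hji : i = j := by simpa using congrArg Prod.snd hk
    exact (mem_contactNbrs.1 hj).1 hji.symm
  have hdF : Disjoint (R₁ ∪ R₂) F := by
    rw [Finset.disjoint_left]
    intro p hp hpF
    obtain ⟨-, hF1, hF2⟩ := Finset.mem_filter.1 hpF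
    rcases Finset.mem_union.1 hp with hp | hp
    · obtain ⟨j, -, rfl⟩ := Finset.mem_image.1 hp
      exact hF1 rfl
    · obtain ⟨j, -, rfl⟩ := Finset.mem_image.1 hp
      exact hF2 rfl
  have hsub : R₁ ∪ R₂ ∪ F ⊆ contactPairs x := by
    intro p hp
    rcases Finset.mem_union.1 hp with hp | hp
    · rcases Finset.mem_union.1 hp with hp | hp
      · obtain ⟨j, hj, rfl⟩ := Finset.mem_image.1 hp
        exact mem_contactNbrs_iff.1 hj
      · obtain ⟨j, hj, rfl⟩ := Finset.mem_image.1 hp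
        exact swap_mem_contactPairs (mem_contactNbrs_iff.1 hj)
    · exact (Finset.mem_filter.1 hp).1
  have := Finset.card_le_card hsub
  rw [Finset.card_union_of_disjoint hdF, Finset.card_union_of_disjoint hd12, h1, h2] at this
  omega

end Nbrs

/-! ### Part B. Chordal/inner-product dictionary for unit vectors (strict forms) -/

section Unit

variable {E : Type*} [NormedAddCommGroup E] [InnerProductSpace ℝ E]

/-- For unit vectors, `m < dist x y ↔ ⟪x, y⟫ < 1 − m²/2` (`m ≥ 0`). [folklore] -/
theorem lt_dist_iff_inner_lt_of_unit {x y : E} (hx : ‖x‖ = 1) (hy : ‖y‖ = 1) {m : ℝ}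
    (hm : 0 ≤ m) : m < dist x y ↔ ⟪x, y⟫ < 1 - m ^ 2 / 2 := by
  have h2 : dist x y ^ 2 = 2 - 2 * ⟪x, y⟫ := by
    rw [dist_eq_norm, norm_sub_sq_real, hx, hy]; ring
  constructor
  · intro h
    have : m ^ 2 < dist x y ^ 2 := pow_lt_pow_left₀ h hm two_ne_zero
    linarith
  · intro h
    have : m ^ 2 < dist x y ^ 2 := by rw [h2]; linarith
    exact lt_of_pow_lt_pow_left₀ 2 dist_nonneg this

/-- For unit vectors the distance is a function of the inner product:
`dist x y = dist x' y' ↔ ⟪x, y⟫ = ⟪x', y'⟫`. [folklore] -/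
theorem dist_eq_dist_iff_inner_eq_of_unit {x y x' y' : E} (hx : ‖x‖ = 1) (hy : ‖y‖ = 1)
    (hx' : ‖x'‖ = 1) (hy' : ‖y'‖ = 1) : dist x y = dist x' y' ↔ ⟪x, y⟫ = ⟪x', y'⟫ := by
  have h2 : dist x y ^ 2 = 2 - 2 * ⟪x, y⟫ := by
    rw [dist_eq_norm, norm_sub_sq_real, hx, hy]; ring
  have h2' : dist x' y' ^ 2 = 2 - 2 * ⟪x', y'⟫ := by
    rw [dist_eq_norm, norm_sub_sq_real, hx', hy']; ring
  constructor
  · intro h; rw [h] at h2; linarith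
  · intro h
    have : dist x y ^ 2 = dist x' y' ^ 2 := by rw [h2, h2', h]
    exact (pow_left_inj₀ dist_nonneg dist_nonneg two_ne_zero).1 this

end Unit

/-! ### Part C. Vertices of low degree admit shifts (`ψ < 90°`) -/

section Shift

variable {E : Type*} [NormedAddCommGroup E] [InnerProductSpace ℝ E] {N : ℕ}

/-- **The shift construction.**  Let `x` be a unit configuration with `ψ(x) < √2` (contact
neighbours at acute angle) and `i` a label.  If some nonzero vector `n` is orthogonal to all
contact neighbours `x j` of `x i`, then `i` admits a shift: replacing `n` by `−n` if necessary so
that `⟪x i, n⟫ ≥ 0`, the unit vectors `y_ε = (x i + ε n)/‖x i + ε n‖` (`ε > 0`) satisfy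
`⟪y_ε, x j⟫ = ⟪x i, x j⟫/‖x i + ε n‖ < ⟪x i, x j⟫` for every contact neighbour (`‖x i + ε n‖ > 1`
and `⟪x i, x j⟫ > 0`), i.e. `dist(y_ε, x j) > ψ`, while for the finitely many non-neighbours
`dist(x i, x j) > ψ` persists for `ε` small since `y_ε → x i`.  (This is how the printed proofs
produce shifts: "a 'concave' vertex of a polygon `P` can be shifted to the interior of `P`";
here the directions available are the normals to the span of the contacts.)
[cite: MusinTarasov2012, §2.1 (Shift of a single vertex) and Proposition 3.2] -/
theorem hasShift_of_exists_orthogonal {x : Fin N → E} (hx : x ∈ unitConfigs N E) (i : Fin N)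
    (hψ : minDist x < Real.sqrt 2) {n : E} (hn : n ≠ 0)
    (horth : ∀ j ∈ contactNbrs x i, ⟪n, x j⟫ = 0) : HasShift x i := by
  -- normalise the sign of `n`
  wlog hsign : 0 ≤ ⟪x i, n⟫ generalizing n with H
  · refine H (neg_ne_zero.2 hn) (fun j hj => ?_) ?_
    · rw [inner_neg_left, horth j hj, neg_zero]
    · rw [inner_neg_right]; linarith [le_of_not_ge hsign]
  have hψ0 : 0 ≤ minDist x := minDist_nonneg x
  -- the curve `y ε`
  set z : ℝ → E := fun ε => x i + ε • n with hzdef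
  have hz2 : ∀ ε, ‖z ε‖ ^ 2 = 1 + 2 * ε * ⟪x i, n⟫ + ε ^ 2 * ‖n‖ ^ 2 := by
    intro ε
    rw [hzdef]
    simp only
    rw [norm_add_sq_real, hx i, real_inner_smul_right, norm_smul, mul_pow, Real.norm_eq_abs,
      sq_abs]
    ring
  have hz1 : ∀ ε, 0 < ε → 1 < ‖z ε‖ := by
    intro ε hε
    have hn2 : 0 < ‖n‖ ^ 2 := by positivity
    have : 1 < ‖z ε‖ ^ 2 := by
      rw [hz2]; nlinarith [mul_pos (pow_pos hε 2) hn2, mul_nonneg hε.le hsign]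
    exact lt_of_pow_lt_pow_left₀ 2 (norm_nonneg _) (by simpa using this)
  set y : ℝ → E := fun ε => ‖z ε‖⁻¹ • z ε with hydef
  have hy1 : ∀ ε, 0 < ε → ‖y ε‖ = 1 := by
    intro ε hε
    have h0 : ‖z ε‖ ≠ 0 := by linarith [hz1 ε hε]
    rw [hydef]
    simp only
    rw [norm_smul, norm_inv, norm_norm, inv_mul_cancel₀ h0]
  -- contact neighbours recede for every `ε > 0`
  have hcontact : ∀ ε, 0 < ε → ∀ j ∈ contactNbrs x i, minDist x < dist (y ε) (x j) := by
    intro ε hε j hj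
    obtain ⟨hji, hdj⟩ := mem_contactNbrs.1 hj
    have hpos : 0 < ⟪x i, x j⟫ :=
      (dist_lt_sqrt_two_iff_inner_pos (hx i) (hx j)).1 (hdj ▸ hψ)
    have hin : ⟪y ε, x j⟫ = ‖z ε‖⁻¹ * ⟪x i, x j⟫ := by
      rw [hydef]
      simp only
      rw [real_inner_smul_left, hzdef]
      simp only
      rw [inner_add_left, real_inner_smul_left, horth j hj, mul_zero, add_zero]
    have hlt : ⟪y ε, x j⟫ < ⟪x i, x j⟫ := by
      rw [hin]
      have hz := hz1 ε hε
      have : ‖z ε‖⁻¹ < 1 := inv_lt_one_of_one_lt₀ hz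
      nlinarith
    have hψj : ⟪x i, x j⟫ = 1 - minDist x ^ 2 / 2 :=
      (dist_eq_iff_inner_eq_of_unit (hx i) (hx j) hψ0).1 hdj
    exact (lt_dist_iff_inner_lt_of_unit (hy1 ε hε) (hx j) hψ0).2 (by linarith)
  -- `y ε → x i` as `ε → 0`
  have hcont : Tendsto y (𝓝[>] 0) (𝓝 (x i)) := by
    have hzc : Continuous z := by
      rw [hzdef]; exact continuous_const.add (continuous_id.smul continuous_const)
    have hz0 : z 0 = x i := by rw [hzdef]; simp
    have hnc : ContinuousAt (fun ε => ‖z ε‖⁻¹) 0 := by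
      refine (hzc.norm.continuousAt).inv₀ ?_
      rw [hz0, hx i]; exact one_ne_zero
    have hyc : ContinuousAt y 0 := by
      rw [hydef]; exact hnc.smul hzc.continuousAt
    have hy0 : y 0 = x i := by
      rw [hydef]; simp only; rw [hz0, hx i]; simp
    have := hyc.tendsto
    rw [hy0] at this
    exact this.mono_left nhdsWithin_le_nhds
  -- non-neighbours stay away for small `ε`
  have hfar : ∀ᶠ ε in 𝓝[>] (0 : ℝ), ∀ j, j ≠ i → j ∉ contactNbrs x i →
      minDist x < dist (y ε) (x j) := by
    refine eventually_all.2 fun j => ?_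
    by_cases hji : j ≠ i
    · by_cases hj : j ∈ contactNbrs x i
      · exact Eventually.of_forall fun ε _ h => absurd hj h
      · have hgt : minDist x < dist (x i) (x j) := by
          refine lt_of_le_of_ne (minDist_le_dist x (Ne.symm hji)) fun h => hj ?_
          exact mem_contactNbrs.2 ⟨hji, h.symm⟩
        have hopen : IsOpen {w : E | minDist x < dist w (x j)} :=
          isOpen_lt continuous_const (continuous_id.dist continuous_const)
        have hmem : {w : E | minDist x < dist w (x j)} ∈ 𝓝 (x i) := hopen.mem_nhds hgt
        exact (hcont.eventually_mem hmem).mono fun ε hε _ _ => hε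
    · exact Eventually.of_forall fun ε h => absurd h hji
  have hpos : ∀ᶠ ε in 𝓝[>] (0 : ℝ), 0 < ε := eventually_nhdsWithin_of_forall fun ε hε => hε
  obtain ⟨ε, hε, hεfar⟩ := (hpos.and hfar).exists
  refine ⟨y ε, hy1 ε hε, fun j hji => ?_⟩
  by_cases hj : j ∈ contactNbrs x i
  · exact hcontact ε hε j hj
  · exact hεfar j hji hj

/-- **Few contacts ⇒ shiftable.**  In a finite-dimensional space, if `x i` has fewer contact
neighbours than the dimension (so that their span has a nonzero normal vector) and `ψ(x) < √2`,
then `i` admits a shift.  On `S² ⊂ ℝ³`: every vertex of degree `≤ 2` of a configuration with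
`ψ < 90°` can be shifted — the reason why irreducible contact graphs have no vertices of degree
`1` or `2` (Proposition 3.3). [cite: MusinTarasov2012, Propositions 3.2 and 3.3] -/
theorem hasShift_of_card_contactNbrs_lt_finrank [FiniteDimensional ℝ E] {x : Fin N → E}
    (hx : x ∈ unitConfigs N E) (i : Fin N) (hψ : minDist x < Real.sqrt 2)
    (hdeg : (contactNbrs x i).card < finrank ℝ E) : HasShift x i := by
  classical
  set s : Finset E := (contactNbrs x i).image x with hsdef
  set K : Submodule ℝ E := Submodule.span ℝ (s : Set E) with hKdef
  have hK : finrank ℝ K < finrank ℝ E :=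
    calc finrank ℝ K ≤ s.card := finrank_span_finset_le_card s
      _ ≤ (contactNbrs x i).card := Finset.card_image_le
      _ < finrank ℝ E := hdeg
  have hKo : Kᗮ ≠ ⊥ := by
    intro hbot
    have h1 := Submodule.finrank_add_finrank_orthogonal K
    rw [hbot, finrank_bot] at h1
    omega
  obtain ⟨n, hnK, hn0⟩ := Submodule.exists_mem_ne_zero_of_ne_bot hKo
  refine hasShift_of_exists_orthogonal hx i hψ hn0 fun j hj => ?_
  rw [Submodule.mem_orthogonal] at hnK
  rw [real_inner_comm]
  have hxj : x j ∈ (s : Set E) := by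
    rw [hsdef, Finset.coe_image]
    exact Set.mem_image_of_mem x (Finset.mem_coe.2 hj)
  exact hnK (x j) (Submodule.subset_span hxj)

/-- On `S² ⊂ ℝ³`: a vertex with at most two contact neighbours of a configuration with
`ψ < √2` admits a shift. [cite: MusinTarasov2012, Proposition 3.3] -/
theorem hasShift_of_card_contactNbrs_le_two {x : Fin N → EuclideanSpace ℝ (Fin 3)}
    (hx : x ∈ unitConfigs N (EuclideanSpace ℝ (Fin 3))) (i : Fin N)
    (hψ : minDist x < Real.sqrt 2) (hdeg : (contactNbrs x i).card ≤ 2) : HasShift x i :=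
  hasShift_of_card_contactNbrs_lt_finrank hx i hψ (by rw [finrank_euclideanSpace_fin]; omega)

end Shift

/-! ### Part D. Danzer flips -/

section Flip

variable {E : Type*} [NormedAddCommGroup E] [InnerProductSpace ℝ E] {N : ℕ}

/-- **The flip point**: the mirror image of `z` in the plane spanned by the unit vectors `a, b`
(`⟪a, b⟫² < 1`), i.e. the reflection `2 P z − z` with `P` the orthogonal projection onto
`span {a, b}`, written out: `P z = ((⟪a,z⟫ − μ⟪b,z⟫) a + (⟪b,z⟫ − μ⟪a,z⟫) b)/(1 − μ²)`,
`μ = ⟪a, b⟫`.  On the sphere this is "its mirror image `x′` relative to the great circle `yz`".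
[cite: MusinTarasov2012, §2.1 (Danzer's flip)] -/
def flipPoint (a b z : E) : E :=
  (2 / (1 - ⟪a, b⟫ ^ 2)) • ((⟪a, z⟫ - ⟪a, b⟫ * ⟪b, z⟫) • a + (⟪b, z⟫ - ⟪a, b⟫ * ⟪a, z⟫) • b) - z

/-- The flip fixes the inner product with `a` (the mirror great circle passes through `a`) …
[cite: MusinTarasov2012, §2.1 (Danzer's flip)] -/
theorem inner_flipPoint_left (a b z : E) (ha : ‖a‖ = 1) (hab : ⟪a, b⟫ ^ 2 < 1) :
    ⟪flipPoint a b z, a⟫ = ⟪z, a⟫ := by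
  have haa : ⟪a, a⟫ = 1 := by rw [real_inner_self_eq_norm_sq, ha]; norm_num
  have hba : ⟪b, a⟫ = ⟪a, b⟫ := real_inner_comm _ _
  have hD : 1 - ⟪a, b⟫ ^ 2 ≠ 0 := by linarith
  simp only [flipPoint, inner_sub_left, inner_smul_left, inner_add_left, haa, hba,
    RCLike.conj_to_real]
  rw [real_inner_comm a z]
  field_simp
  ring

/-- … and with `b`. [cite: MusinTarasov2012, §2.1 (Danzer's flip)] -/
theorem inner_flipPoint_right (a b z : E) (hb : ‖b‖ = 1) (hab : ⟪a, b⟫ ^ 2 < 1) :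
    ⟪flipPoint a b z, b⟫ = ⟪z, b⟫ := by
  have hbb : ⟪b, b⟫ = 1 := by rw [real_inner_self_eq_norm_sq, hb]; norm_num
  have hD : 1 - ⟪a, b⟫ ^ 2 ≠ 0 := by linarith
  simp only [flipPoint, inner_sub_left, inner_smul_left, inner_add_left, hbb,
    RCLike.conj_to_real]
  rw [real_inner_comm b z]
  field_simp
  ring

/-- The flip is an isometry: `‖flipPoint a b z‖ = ‖z‖`. [cite: MusinTarasov2012, §2.1] -/
theorem norm_flipPoint (a b z : E) (ha : ‖a‖ = 1) (hb : ‖b‖ = 1) (hab : ⟪a, b⟫ ^ 2 < 1) :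
    ‖flipPoint a b z‖ = ‖z‖ := by
  have haa : ⟪a, a⟫ = 1 := by rw [real_inner_self_eq_norm_sq, ha]; norm_num
  have hbb : ⟪b, b⟫ = 1 := by rw [real_inner_self_eq_norm_sq, hb]; norm_num
  have hba : ⟪b, a⟫ = ⟪a, b⟫ := real_inner_comm _ _
  have hD : 1 - ⟪a, b⟫ ^ 2 ≠ 0 := by linarith
  have h : ⟪flipPoint a b z, flipPoint a b z⟫ = ⟪z, z⟫ := by
    simp only [flipPoint, inner_sub_left, inner_sub_right, inner_smul_left, inner_smul_right,
      inner_add_left, inner_add_right, haa, hbb, hba, RCLike.conj_to_real]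
    rw [real_inner_comm z a, real_inner_comm z b]
    field_simp
    ring
  rw [real_inner_self_eq_norm_sq, real_inner_self_eq_norm_sq] at h
  exact (pow_left_inj₀ (norm_nonneg _) (norm_nonneg _) two_ne_zero).1 h

/-- **Danzer's flip** (Musin–Tarasov, §2.1: "Let `x, y, z` be vertices of `CG(X)` with
`dist(x, y) = dist(x, z) = ψ(X)`. We say that `x` is flipped over `yz` if `x` is replaced by its
mirror image `x′` relative to the great circle `yz`. We say that this flip is Danzer's flip if
`dist(x′, X ∖ {x, y, z}) > ψ(X)`").  For the labelled configuration `x`: the label `i` admits a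
Danzer flip if it has two distinct contact neighbours `j, k` such that the flip point of `x i`
over the great circle through `x j, x k` is at distance `> ψ(x)` from all other points.
[cite: MusinTarasov2012, §2.1 (Danzer's flip)] -/
def HasDanzerFlip (x : Fin N → E) (i : Fin N) : Prop :=
  ∃ j ∈ contactNbrs x i, ∃ k ∈ contactNbrs x i, j ≠ k ∧
    ∀ l, l ≠ i → l ≠ j → l ≠ k → minDist x < dist (flipPoint (x j) (x k) (x i)) (x l)

/-- **Irreducible (jammed) configurations** (Musin–Tarasov, §2.1: "We say that the graph `CG(X)`
is irreducible (or jammed) if there are neither Danzer's flips nor shifts of vertices"; shifts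
are defined for vertices of positive degree).  With `HasShift` in relocation form this is a
stronger property than the printed one. [cite: MusinTarasov2012, §2.1 (Irreducible graphs)] -/
def IsIrreducible (x : Fin N → E) : Prop :=
  (∀ i, (contactNbrs x i).Nonempty → ¬ HasShift x i) ∧ ∀ i, ¬ HasDanzerFlip x i

/-- Two contact neighbours of a vertex are neither equal nor antipodal when `0 < ψ < √2`:
`⟪x j, x k⟫² < 1`. [folklore] -/
theorem sq_inner_lt_one_of_contactNbrs {x : Fin N → E} (hx : x ∈ unitConfigs N E)
    (hinj : Function.Injective x) (hψ : minDist x < Real.sqrt 2) {i j k : Fin N}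
    (hj : j ∈ contactNbrs x i) (hk : k ∈ contactNbrs x i) (hjk : j ≠ k) :
    ⟪x j, x k⟫ ^ 2 < 1 := by
  obtain ⟨-, hdj⟩ := mem_contactNbrs.1 hj
  obtain ⟨-, hdk⟩ := mem_contactNbrs.1 hk
  have hposj : 0 < ⟪x i, x j⟫ := (dist_lt_sqrt_two_iff_inner_pos (hx i) (hx j)).1 (hdj ▸ hψ)
  have hposk : 0 < ⟪x i, x k⟫ := (dist_lt_sqrt_two_iff_inner_pos (hx i) (hx k)).1 (hdk ▸ hψ)
  have hle : |⟪x j, x k⟫| ≤ 1 := by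
    have := abs_real_inner_le_norm (x j) (x k)
    rw [hx j, hx k, mul_one] at this
    exact this
  have hne1 : ⟪x j, x k⟫ ≠ 1 := fun h =>
    hjk (hinj ((inner_eq_one_iff_of_norm_eq_one (hx j) (hx k)).1 h))
  have hne2 : ⟪x j, x k⟫ ≠ -1 := by
    intro h
    have hanti : x j = -x k := (inner_eq_neg_one_iff_of_norm_eq_one (hx j) (hx k)).1 h
    have : ⟪x i, x j⟫ = -⟪x i, x k⟫ := by rw [hanti, inner_neg_right]
    linarith
  have hlt : |⟪x j, x k⟫| < 1 := by
    refine lt_of_le_of_ne hle fun h => ?_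
    rcases abs_eq (zero_le_one) |>.1 h with h' | h'
    · exact hne1 h'
    · exact hne2 h'
  have := abs_lt.1 hlt
  nlinarith [this.1, this.2]

/-- **Proposition 3.2, the flip half: a maximal arrangement with the fewest edges admits no
Danzer flip at a vertex of degree `≥ 3`** (`0 < ψ < √2`).  Flipping `x i` over the great circle
through two contact neighbours `x j, x k` keeps those two contacts (the flip is a reflection
fixing `x j, x k`), keeps `ψ` by maximality, and trades the `2·deg(i) ≥ 6` darts at `i` for the
`4` darts `(i,j), (j,i), (i,k), (k,i)`: strictly fewer contact pairs, contradicting minimality.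
[cite: MusinTarasov2012, Proposition 3.2] -/
theorem IsTammesOptimal.not_hasDanzerFlip_of_three_le {x : Fin N → E}
    (hopt : IsTammesOptimal N E x) (hinj : Function.Injective x) (hψ : minDist x < Real.sqrt 2)
    {i : Fin N} (h3 : 3 ≤ (contactNbrs x i).card) : ¬ HasDanzerFlip x i := by
  classical
  rintro ⟨j, hj, k, hk, hjk, hfar⟩
  have hx := hopt.mem
  have hψ0 : 0 ≤ minDist x := minDist_nonneg x
  obtain ⟨hji, hdj⟩ := mem_contactNbrs.1 hj
  obtain ⟨hki, hdk⟩ := mem_contactNbrs.1 hk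
  have hμ : ⟪x j, x k⟫ ^ 2 < 1 := sq_inner_lt_one_of_contactNbrs hx hinj hψ hj hk hjk
  set z := flipPoint (x j) (x k) (x i) with hzdef
  have hz1 : ‖z‖ = 1 := by rw [hzdef, norm_flipPoint _ _ _ (hx j) (hx k) hμ, hx i]
  have hzj : dist z (x j) = dist (x i) (x j) := by
    rw [dist_eq_dist_iff_inner_eq_of_unit hz1 (hx j) (hx i) (hx j), hzdef,
      inner_flipPoint_left _ _ _ (hx j) hμ]
  have hzk : dist z (x k) = dist (x i) (x k) := by
    rw [dist_eq_dist_iff_inner_eq_of_unit hz1 (hx k) (hx i) (hx k), hzdef,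
      inner_flipPoint_right _ _ _ (hx k) hμ]
  have hne : (distinctPairs N).Nonempty := distinctPairs_nonempty hji
  -- the flipped configuration
  set x' : Fin N → E := Function.update x i z with hx'def
  have hx' : x' ∈ unitConfigs N E := update_mem_unitConfigs hx i hz1
  have hx'i : x' i = z := by simp [hx'def]
  have hx'l : ∀ l, l ≠ i → x' l = x l := fun l hl => by simp [hx'def, Function.update_of_ne hl]
  -- distances from the new point
  have hnew : ∀ l, l ≠ i → minDist x ≤ dist z (x l) ∧
      (dist z (x l) = minDist x → l = j ∨ l = k) := by
    intro l hl
    by_cases hlj : l = j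
    · subst hlj; exact ⟨by rw [hzj, hdj], fun _ => Or.inl rfl⟩
    by_cases hlk : l = k
    · subst hlk; exact ⟨by rw [hzk, hdk], fun _ => Or.inr rfl⟩
    have := hfar l hl hlj hlk
    exact ⟨this.le, fun h => absurd h (ne_of_gt this)⟩
  -- `ψ(x') = ψ(x)`
  have hge : minDist x ≤ minDist x' := by
    refine le_minDist x' hne fun p q hpq => ?_
    by_cases hp : p = i
    · subst hp
      rw [hx'i, hx'l q (Ne.symm hpq)]
      exact (hnew q (Ne.symm hpq)).1
    by_cases hq : q = i
    · subst hq
      rw [hx'i, hx'l p hp, dist_comm]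
      exact (hnew p hp).1
    rw [hx'l p hp, hx'l q hq]
    exact minDist_le_dist x hpq
  have heq : minDist x' = minDist x := le_antisymm (hopt.isMaxOn hx') hge
  -- contact pairs of `x'`: old ones avoiding `i`, or one of the four darts at `i`
  set F := (contactPairs x).filter (fun p => p.1 ≠ i ∧ p.2 ≠ i) with hFdef
  set Q : Finset (Fin N × Fin N) := {(i, j), (j, i), (i, k), (k, i)} with hQdef
  have hsub : contactPairs x' ⊆ F ∪ Q := by
    intro p hp
    obtain ⟨hpne, hpd⟩ := mem_contactPairs.1 hp
    rw [heq] at hpd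
    rw [Finset.mem_union]
    by_cases hp1 : p.1 = i
    · have hp2 : p.2 ≠ i := fun h => hpne (hp1.trans h.symm)
      rw [hp1, hx'i, hx'l p.2 hp2] at hpd
      right
      rcases (hnew p.2 hp2).2 hpd with h | h
      · have : p = (i, j) := Prod.ext hp1 h
        rw [this, hQdef]; simp
      · have : p = (i, k) := Prod.ext hp1 h
        rw [this, hQdef]; simp
    by_cases hp2 : p.2 = i
    · rw [hp2, hx'i, hx'l p.1 hp1, dist_comm] at hpd
      right
      rcases (hnew p.1 hp1).2 hpd with h | h
      · have : p = (j, i) := Prod.ext h hp2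
        rw [this, hQdef]; simp
      · have : p = (k, i) := Prod.ext h hp2
        rw [this, hQdef]; simp
    left
    rw [hx'l p.1 hp1, hx'l p.2 hp2] at hpd
    exact Finset.mem_filter.2 ⟨mem_contactPairs.2 ⟨hpne, hpd⟩, hp1, hp2⟩
  have hQ : Q.card ≤ 4 := by
    rw [hQdef]
    refine (Finset.card_insert_le _ _).trans ?_
    refine (Nat.succ_le_succ (Finset.card_insert_le _ _)).trans ?_
    refine (Nat.succ_le_succ (Nat.succ_le_succ (Finset.card_insert_le _ _))).trans ?_
    simp
  have h1 : (contactPairs x').card ≤ F.card + 4 :=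
    (Finset.card_le_card hsub).trans ((Finset.card_union_le _ _).trans (by omega))
  have h2 := two_mul_card_contactNbrs_add_le x i
  rw [← hFdef] at h2
  have h3 := hopt.card_le hx' heq
  omega

end Flip

/-! ### Part E. Maximal arrangements on `S²` with `N ≥ 7` points: irreducibility and degrees -/

section SphereTwo

variable {N : ℕ}

/-- For `N ≥ 7` a maximal arrangement on `S²` has `0 < ψ = d_N < √2`.
[cite: MusinTarasov2012, Proposition 3.2 (N > 6)] -/
theorem IsTammesOptimal.minDist_lt_sqrt_two {x : Fin N → EuclideanSpace ℝ (Fin 3)}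
    (hN : 7 ≤ N) (hopt : IsTammesOptimal N (EuclideanSpace ℝ (Fin 3)) x) :
    minDist x < Real.sqrt 2 := by
  rw [hopt.minDist_eq]; exact maxMinDist_lt_sqrt_two_of_seven_le hN

/-- **Proposition 3.3 with 3.2 (lower part): in a maximal arrangement with the fewest edges of
`N ≥ 7` points of `S²`, every vertex has degree `0` or `≥ 3`** (vertices of degree `1, 2` could
be shifted). [cite: MusinTarasov2012, Propositions 3.2 and 3.3] -/
theorem IsTammesOptimal.card_contactNbrs_eq_zero_or_three_le
    {x : Fin N → EuclideanSpace ℝ (Fin 3)} (hN : 7 ≤ N)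
    (hopt : IsTammesOptimal N (EuclideanSpace ℝ (Fin 3)) x) (i : Fin N) :
    (contactNbrs x i).card = 0 ∨ 3 ≤ (contactNbrs x i).card := by
  by_contra h
  push Not at h
  obtain ⟨h0, h3⟩ := h
  have hne : (contactNbrs x i).Nonempty := Finset.card_pos.1 (Nat.pos_of_ne_zero h0)
  obtain ⟨j, hj⟩ := hne
  exact hopt.not_hasShift ⟨j, mem_contactNbrs_iff.1 hj⟩
    (hasShift_of_card_contactNbrs_le_two hopt.mem i (hopt.minDist_lt_sqrt_two hN) (by omega))

/-- **Proposition 3.3 (upper part) for labelled arrangements: at most five contact neighbours**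
(any injective unit configuration of `S²` with `ψ < √2`; from `card_le_five_of_neighbours` of
`SphericalCodeContactGraph.lean`). [cite: MusinTarasov2012, Proposition 3.3] -/
theorem card_contactNbrs_le_five {x : Fin N → EuclideanSpace ℝ (Fin 3)}
    (hx : x ∈ unitConfigs N (EuclideanSpace ℝ (Fin 3))) (hinj : Function.Injective x)
    (hψ : minDist x < Real.sqrt 2) (i : Fin N) : (contactNbrs x i).card ≤ 5 := by
  classical
  have hψ0 : 0 ≤ minDist x := minDist_nonneg x
  set κ : ℝ := 1 - minDist x ^ 2 / 2 with hκdef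
  have hs2 : Real.sqrt 2 ^ 2 = 2 := Real.sq_sqrt (by norm_num)
  have hκ₂ : -1 < κ := by
    have : minDist x ^ 2 < Real.sqrt 2 ^ 2 := pow_lt_pow_left₀ hψ hψ0 two_ne_zero
    rw [hκdef]; linarith
  by_cases hdeg : (contactNbrs x i).card = 0
  · omega
  obtain ⟨j₀, hj₀⟩ := Finset.card_pos.1 (Nat.pos_of_ne_zero hdeg)
  have hψpos : 0 < minDist x := by
    obtain ⟨hji, -⟩ := mem_contactNbrs.1 hj₀
    exact (minDist_pos_iff x (distinctPairs_nonempty hji)).2 hinj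
  have hκ₁ : κ < 1 := by rw [hκdef]; nlinarith
  have hcard : ((contactNbrs x i).image x).card = (contactNbrs x i).card :=
    Finset.card_image_of_injective _ hinj
  rw [← hcard]
  refine card_le_five_of_neighbours (hx i) hκ₁ hκ₂ ?_ ?_ ?_
  · simp only [Finset.mem_image, forall_exists_index, and_imp]
    rintro _ j - rfl; exact hx j
  · simp only [Finset.mem_image, forall_exists_index, and_imp]
    rintro _ j hj rfl
    exact (dist_eq_iff_inner_eq_of_unit (hx i) (hx j) hψ0).1 (mem_contactNbrs.1 hj).2
  · simp only [Finset.mem_image, forall_exists_index, and_imp]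
    rintro _ j - rfl _ l - rfl hjl
    have hjl' : j ≠ l := fun e => hjl (by rw [e])
    exact (le_dist_iff_inner_le_of_unit (hx j) (hx l) hψ0).1 (minDist_le_dist x hjl')

/-- **Musin–Tarasov, Proposition 3.2 (from Danzer) for the arrangements used in the proof: a
maximal arrangement with the fewest edges of `N ≥ 7` points of `S²` is irreducible** — no vertex
of positive degree admits a shift (even in relocation form) and no vertex admits a Danzer flip.
[cite: MusinTarasov2012, Proposition 3.2] -/
theorem IsTammesOptimal.isIrreducible {x : Fin N → EuclideanSpace ℝ (Fin 3)} (hN : 7 ≤ N)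
    (hopt : IsTammesOptimal N (EuclideanSpace ℝ (Fin 3)) x) : IsIrreducible x := by
  have hψ := hopt.minDist_lt_sqrt_two hN
  have hinj : Function.Injective x :=
    hopt.injective (by rw [finrank_euclideanSpace_fin]; omega) (by omega)
  refine ⟨fun i hne => ?_, fun i hflip => ?_⟩
  · obtain ⟨j, hj⟩ := hne
    exact hopt.not_hasShift ⟨j, mem_contactNbrs_iff.1 hj⟩
  · rcases hopt.card_contactNbrs_eq_zero_or_three_le hN i with h0 | h3
    · obtain ⟨j, hj, -⟩ := hflip
      rw [Finset.card_eq_zero] at h0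
      rw [h0] at hj
      simp at hj
    · exact hopt.not_hasDanzerFlip_of_three_le hinj hψ h3 hflip

/-- **Corollary 3.1 (degrees) for these arrangements: every vertex has degree `0, 3, 4` or `5`.**
[cite: MusinTarasov2012, Proposition 3.3 and Corollary 3.1] -/
theorem IsTammesOptimal.card_contactNbrs_mem {x : Fin N → EuclideanSpace ℝ (Fin 3)} (hN : 7 ≤ N)
    (hopt : IsTammesOptimal N (EuclideanSpace ℝ (Fin 3)) x) (i : Fin N) :
    (contactNbrs x i).card = 0 ∨ (3 ≤ (contactNbrs x i).card ∧ (contactNbrs x i).card ≤ 5) := by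
  have hinj : Function.Injective x :=
    hopt.injective (by rw [finrank_euclideanSpace_fin]; omega) (by omega)
  have h5 := card_contactNbrs_le_five hopt.mem hinj (hopt.minDist_lt_sqrt_two hN) i
  rcases hopt.card_contactNbrs_eq_zero_or_three_le hN i with h | h
  · exact Or.inl h
  · exact Or.inr ⟨h, h5⟩

/-- **Existence (the input of §§3–4): for every `N ≥ 7` there is an arrangement of `N` points of
`S²` with `ψ = d_N`, irreducible contact graph, and all degrees in `{0, 3, 4, 5}`.**
[cite: MusinTarasov2012, Proposition 3.2 and Corollary 3.1] -/
theorem exists_isTammesOptimal_isIrreducible (hN : 7 ≤ N) :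
    ∃ x : Fin N → EuclideanSpace ℝ (Fin 3), IsTammesOptimal N _ x ∧
      minDist x = maxMinDist N (EuclideanSpace ℝ (Fin 3)) ∧ IsIrreducible x ∧
      ∀ i, (contactNbrs x i).card = 0 ∨
        (3 ≤ (contactNbrs x i).card ∧ (contactNbrs x i).card ≤ 5) := by
  obtain ⟨x, hopt⟩ := exists_isTammesOptimal (E := EuclideanSpace ℝ (Fin 3)) N
  exact ⟨x, hopt, hopt.minDist_eq, hopt.isIrreducible hN, hopt.card_contactNbrs_mem hN⟩

end SphereTwo

end Literature.Geometry.DiscreteGeometry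

end
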